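import Summits.PneNP.PneNP.Theses.ConvexRankGates
import Summits.PneNP.PneNP.Theorems.ConvexRankGatesConvexGateBlindRankForm
import Summits.PneNP.PneNP.Theorems.ConvexRankGatesConvexGateBlindCliqueDistanceSdp

set_option linter.dupNamespace false

/-!
# Line `strict-rank-conic-cover` — crux `ConvexGateBlind` (stmt-PneNP-10680, route PneNP/ConvexRankGates)

Skeleton (crux-plan, round 1).  Idea card `Cruxes/ConvexGateBlind/Ideas/strict-rank-conic-cover.md`:
kill `ε` exactly — by Hrubeš (ECCC TR19-034, Lemma 16 / Prop. 17 / Thm. 20) the crux is a STRICT-RANK statement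
about ONE explicit matrix family, the one-sided clique distances `D[Q,u] = #(E(Q) ∖ u)` (`Q` the `k`-subsets of
`Fin m`, `u` the `k`-clique-free graphs, `k = ⌈m^δ⌉₊`).  The provers have already landed the `ε`-form of this
(`Summit.PneNP.PneNP.Theorems.convexGateBlind_iff_cliqueDistConeRankHard`, file
`Theorems/ConvexRankGatesConvexGateBlindCanonicalForm.lean`): the crux holds iff for some `δ ∈ (0,1/2)` and every
`c`, eventually, for every `ε > 0`, `D − εJ` has no factorisation through the cone `PSD_q × ℝ^r_{≥0}` with
`q + r ≤ m^c`.

CURRENCY OF THIS LINE = POTENTIALS (the card's Lever, third equivalent form; Hrubeš Lemma 16 (ii)): a *potential*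
is a positive rank-one minorant `a ⊗ b` of `D` (`a > 0` on `k`-sets, `b > 0` on clique-free graphs);
`ConeFactorisable m k q r a b` says `D − a ⊗ b` factorises through `PSD_q × ℝ^r_{≥0}`;
`StrictConeRankHard m k s` says NO potential does so with `q + r ≤ s` (strict cone rank of `D_{m,k}` exceeds
`s + 1`).  The constant potential `a ≡ ε, b ≡ 1` is the crux's `ε`; the UNIT potential `a ≡ b ≡ 1` (tight exactly on
the distance-1 pairs) gives the Karchmer–Wigderson slack `D − J = #witnesses − 1` (GJW16 §2), the `ε = 1` level.

STUBS (registered; each a genuine lemma of the line, stated over tree declarations + the three `def`s below):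
* `stub_exponentDown`      — hardness propagates DOWNWARD in the exponent `δ` at the matrix level (the converse
                              direction of `Disproof.cliqueHard_mono`, §E; apex + isolated-vertex padding = the
                              submatrix embeddings `D_{m,k} ⊆ D_{m',k'}` for `k ≤ k'`, `m − k ≤ m' − k'`, plus the
                              exponent bookkeeping of Disproof §E.3).  TRUE, M/L-sized.  Lets the heart be fought
                              at ONE exponent (`k = ⌈√m⌉`, triage r1-1/r1-2 sharpen (1)).
* `stub_unitPotentialHard` — the `ε = 1` / trivial-potential level: the KW slack `D − J` of `CLIQUE(m, ⌈√m⌉)` has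
                              superpolynomial `(PSD ⊕ LP)`-cone rank.  Necessary for the crux; LP part = GJW16-type
                              lifting transported to CLIQUE (sibling card xor-door), PSD part open.  XL⁻.
* `stub_potentialGap`      — HARDEST, the bet ("no potential beats the trivial one by more than a polynomial",
                              card, Why-it-bites 2): from a cone factorisation of `D − a ⊗ b` of size `(q, r)` build
                              one of `D − J` of size `≤ (q + r + m + 2)^{C₁}`, uniformly in `(m, k)`.  This is the
                              B1-defying step (robust techniques cannot see `ε → 0`); intended mechanism: peeling /
                              level-by-level flattening of the potential along the self-similar blocks
                              `D|_{X_C × U_F} = |F|·J + D_{m−|C|,k−|C|}` (card items 3–4).  XL.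
COMPOSITION (kernel-checked, no sorry): `stub_unitPotentialHard ∧ stub_potentialGap ⇒ StrictConeRankHard` at
`δ = 1/2` eventually for every `c`; `stub_exponentDown` moves it to `δ = 1/4 < 1/2`; specialising the potential
to `a ≡ ε, b ≡ 1` gives the right-hand side of `convexGateBlind_iff_cliqueDistConeRankHard`, hence the crux:
`ConvexGateBlind_of`, assembled in `ConvexGateBlind_skeleton`.  (At filing time the farm had not yet BUILT
`…CanonicalForm.lean`, so `convexGateBlind_of_strictConeRankHard` re-derives the needed half from the built modules
`…OneGate` / `…RankForm` / `…CliqueDistanceSdp`; once CanonicalForm is served the 6-line proof via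
`convexGateBlind_iff_cliqueDistConeRankHard.mpr` may replace it.)

DISPROOF USED (`Cruxes/ConvexGateBlind/Disproof.lean`, cdisprove gen 2 v7): §A1 width (`not_cliqueHardNoWidth`) is the
bound `q + r ≤ m^c` of `stub_unitPotentialHard` and the polynomial `(q+r+m+2)^{C₁}` of `stub_potentialGap` — without it
`D − J` always factorises with `r = C(m,k)` terms; §A2 size enters through §C (collapse), already inside the canonical
form we start from; §A3/§A4 (`not_cliqueHardConst`, `not_cliqueHardAllM`): `k = ⌈√m⌉ → ∞` and `∀ᶠ m`, and
`stub_potentialGap` is trivially true for `k ≤ C₁` (both sides polynomial), as it must be; §A5 (`B ≥ 0`,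
`cliqueHardSigned_imp_deMorgan`): the matrix is the ONE-SIDED distance `M_+`, all factors non-negative — never the
two-sided Hamming matrix of Hrubeš Thm 3 (prover seat 3's sparse-negatives barrier: columns here are ALL clique-free
graphs, dense ones included, and any proof of the stubs must use them); §B (`not_blindOnRazborovPair`): no stub
restricts columns to colourings; §D (weak infeasibility): sidestepped — everything is stated on the matrix side of the
proved canonical form (trace-normalised certificates already inside `convexGateBlind_iff_cliqueDistConeRankHard`);
§E (`cliqueHard_mono`, `convexGateBlind_iff_interval`, `not_cliqueHard_one`): `stub_exponentDown` is the missing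
converse direction; both stay inside `0 < δ < 1`.  No `Negative/` lemma exists for this crux yet;
`ledger negatives --problem PneNP` (5 items) — no overlap.
-/

namespace Summit.PneNP.PneNP.Cruxes.ConvexGateBlind.StrictRankConicCover

open Matrix Finset Filter Literature.Computability.Complexity
open Summit.PneNP.PneNP.Theses.ConvexRankGates (ConvexGateBlind)

noncomputable section

/-! ## Definitions (copy this block verbatim into any `--supports` file proving a stub) -/

/-- Edges of `K_m` — the input positions of `CLIQUE(m, ·)`. -/
abbrev Edge (m : ℕ) : Type := (⊤ : SimpleGraph (Fin m)).edgeSet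

/-- One-sided clique distance `D[Q,u] = #(E(Q) ∖ u)` as a real number — literally the expression of the
canonical form `convexGateBlind_iff_cliqueDistConeRankHard` (Hrubeš's `M_+(CLIQUE)`; entries in `[1, C(k,2)]`
when `#Q = k` and `u` is `k`-clique-free). -/
def cdist {m : ℕ} (Q : Finset (Fin m)) (u : Edge m → Bool) : ℝ :=
  ∑ e, if cliqueVec Q e = true ∧ u e = false then (1 : ℝ) else 0

/-- `ConeFactorisable m k q r a b`: the matrix `D[Q,u] − a(Q)·b(u)` on (`k`-subsets `Q` of `Fin m`) ×
(`k`-clique-free graphs `u`) factorises through the cone `PSD_q × ℝ^r_{≥0}`: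
`D[Q,u] − a(Q) b(u) = tr(H_u Y_Q) + ∑_{l<r} U_{u,l} V_{l,Q}` with `H_u, Y_Q ⪰ 0` (`q × q`) and `U, V ≥ 0`.
(For `a ≡ ε`, `b ≡ 1` this is exactly the factorisation forbidden by the canonical form of the crux.) -/
def ConeFactorisable (m k q r : ℕ) (a : Finset (Fin m) → ℝ) (b : (Edge m → Bool) → ℝ) : Prop :=
  ∃ (H : (Edge m → Bool) → Matrix (Fin q) (Fin q) ℝ) (Y : Finset (Fin m) → Matrix (Fin q) (Fin q) ℝ)
    (U : (Edge m → Bool) → Fin r → ℝ) (V : Fin r → Finset (Fin m) → ℝ),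
    (∀ u, cliqueFn m k u = false → (H u).PosSemidef) ∧
    (∀ Q : Finset (Fin m), Q.card = k → (Y Q).PosSemidef) ∧
    (∀ u l, 0 ≤ U u l) ∧ (∀ l Q, 0 ≤ V l Q) ∧
    ∀ (Q : Finset (Fin m)) (u : Edge m → Bool), Q.card = k → cliqueFn m k u = false →
      cdist Q u - a Q * b u = (H u * Y Q).trace + ∑ l, U u l * V l Q

/-- `StrictConeRankHard m k s` — the `ε`-free (strict-rank) form of the crux at finite size: NO potential
`a ⊗ b` (`a > 0` on `k`-sets, `b > 0` on `k`-clique-free graphs) leaves a `(PSD_q × ℝ^r_{≥0})`-factorisation of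
`D − a ⊗ b` with `q + r ≤ s` (Hrubeš Lemma 16 (ii): the strict cone rank of `D_{m,k}` exceeds `s + 1`). -/
def StrictConeRankHard (m k s : ℕ) : Prop :=
  ∀ q r : ℕ, q + r ≤ s → ∀ (a : Finset (Fin m) → ℝ) (b : (Edge m → Bool) → ℝ),
    (∀ Q : Finset (Fin m), Q.card = k → 0 < a Q) → (∀ u, cliqueFn m k u = false → 0 < b u) →
      ¬ ConeFactorisable m k q r a b

/-! ## The stubs (registered obligations; `sorry` lives only here) -/

/-- **stub_exponentDown** (support-type, TRUE, M/L): strict cone-rank hardness of the clique-distance family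
propagates DOWNWARD in the exponent: for `0 < δ' ≤ δ < 1`, hardness at `k = ⌈m^δ⌉₊` (every `c`, eventually)
implies hardness at `k = ⌈m^δ'⌉₊`.  Proof plan: (i) SUBMATRIX MONOTONICITY — for `k ≤ k'` and `m − k ≤ m' − k'`,
`D_{m,k}` is the submatrix of `D_{m',k'}` on rows `Q ∪ A` (`A` a fixed set of `k' − k` apex vertices) and columns
`u ∪ (all edges at A)` (isolated vertices pad `m` up), so `ConeFactorisable m' k' q r a b` restricts to
`ConeFactorisable m k q r a' b'` (same `q, r`; `H, Y` PSD and `U, V ≥ 0` restrict); (ii) EXPONENT BOOKKEEPING —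
given a cheap instance at `(m', ⌈m'^δ'⌉₊)` take `m ≈ m'^{δ'/δ}` with `⌈m^δ⌉₊ ≤ ⌈m'^δ'⌉₊` (discrete IVT as in
Disproof §E.3 `exists_sub_ceil_eq`), sizes `m'^{c'} ≤ m^{⌈c'δ/δ'⌉+1}`.  This is the converse direction of
Disproof §E `cliqueHard_mono` (which is apex padding only), stated on the matrix side.
[sources: Disproof.lean §E (`cliqueFn_extV`, `ConvData.pad`, `exists_sub_ceil_eq`); Hrubes2020 §3.4] -/
theorem stub_exponentDown :
    ∀ δ δ' : ℝ, 0 < δ' → δ' ≤ δ → δ < 1 →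
      (∀ c : ℕ, ∀ᶠ m : ℕ in atTop, StrictConeRankHard m ⌈(m : ℝ) ^ δ⌉₊ (m ^ c)) →
        ∀ c : ℕ, ∀ᶠ m : ℕ in atTop, StrictConeRankHard m ⌈(m : ℝ) ^ δ'⌉₊ (m ^ c) := by
  sorry

/-- **stub_unitPotentialHard** (crux-type, XL⁻; NECESSARY for the crux): the `ε = 1` / trivial-potential level.
The Karchmer–Wigderson slack matrix `D − J` of `CLIQUE(m, ⌈√m⌉)` — entry `#(E(Q) ∖ u) − 1 = #KW-witnesses − 1`,
zero exactly on the distance-1 pairs — has superpolynomial `(PSD_q × ℝ^r_{≥0})`-cone rank: for every `c`,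
eventually no factorisation with `q + r ≤ m^c`.  LP part (`q = 0`): non-negative rank of the clique-inequality
slack of the `k`-clique-free-subgraph polytope; route = Razborov rank measure / GJW16 lifting (Thm 1, §2) for a
gadget-composed CSP, transported to CLIQUE by the monotone projection of the sibling line (xor-door, FirstLemmaB3)
— in print modulo transport; PSD part: LRS-type SOS-degree-to-psd-rank transfer, open.  Why it might fail: only
through the PSD part (a poly-size SDP exact on cliques vs. distance-≥2 graphs) — which would refute the crux itself.
[sources: GoosJainWatson2016 = arXiv:1604.07062 §2 + Thm 1; Hrubes2020 Thm 20; LeeRaghavendraSteurer2015] -/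
theorem stub_unitPotentialHard :
    ∀ c : ℕ, ∀ᶠ m : ℕ in atTop, ∀ q r : ℕ, q + r ≤ m ^ c →
      ¬ ConeFactorisable m ⌈(m : ℝ) ^ (1 / 2 : ℝ)⌉₊ q r (fun _ => 1) (fun _ => 1) := by
  sorry

/-- **stub_potentialGap** (crux-type, XL, HARDEST — the bet of the line): *no potential beats the unit potential
by more than a polynomial*, uniformly in `(m, k)`: from a `(PSD_q × ℝ^r_{≥0})`-factorisation of `D − a ⊗ b`
(`a, b > 0`) one can build one of the KW slack `D − J` of total size `≤ (q + r + m + 2)^{C₁}`.  Equivalently (Hrubeš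
L16/P17): `cone-rk(D_{m,k} − J) ≤ poly(strict-cone-rk(D_{m,k}), m)`.  Trivially true for `k ≤ C₁` or `k ≥ m − C₁`
(`D − J` has `≤ C(m,k)` rows); the content is the B1-defying comparison as the potential degenerates (`a ⊗ b = εJ`,
`ε → 0`, is the cleanest special case: "the cost of `D − εJ` is polynomially flat in `ε ∈ (0,1]`").  Intended
mechanism (card items 2–4): tight pairs of any potential live on the distance-1 graph `G₁` (no isolated vertices),
tight sets are cyclically monotone; PEEL the potential level by level (`+#E` terms per factor-`Λ` level) using the
self-similar blocks `D|_{X_C×U_F} = |F|·J + D_{m−|C|,k−|C|}`; the open sub-problem is the direct-sum glue over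
overlapping blocks / potentials of wild dynamic range.  Honours triage r1-3: the statement is about FULL-SUPPORT
matrices `D − a⊗b` (no zeros assumed).  Why it might fail: a cheap exotic potential at some intermediate `k` with
`D − J` expensive — would itself be news (Hrubeš OP2-type discontinuity inside one explicit family).
[sources: Hrubes2020 L14/L16/P17/Thm 15; card strict-rank-conic-cover items 2–4; FGGR ITCS 2022 (msep₁ only)] -/
theorem stub_potentialGap :
    ∃ C₁ : ℕ, ∀ (m k q r : ℕ) (a : Finset (Fin m) → ℝ) (b : (Edge m → Bool) → ℝ),
      (∀ Q : Finset (Fin m), Q.card = k → 0 < a Q) → (∀ u, cliqueFn m k u = false → 0 < b u) →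
        ConeFactorisable m k q r a b →
          ∃ q' r' : ℕ, q' + r' ≤ (q + r + m + 2) ^ C₁ ∧
            ConeFactorisable m k q' r' (fun _ => 1) (fun _ => 1) := by
  sorry

/-! ## Stub statements by name (for the by-name hypothesis audit of `ConvexGateBlind_of`; bodies verbatim) -/

namespace Stub

/-- Statement of `stub_exponentDown` (verbatim). -/
def stub_exponentDown : Prop :=
  ∀ δ δ' : ℝ, 0 < δ' → δ' ≤ δ → δ < 1 →
    (∀ c : ℕ, ∀ᶠ m : ℕ in atTop, StrictConeRankHard m ⌈(m : ℝ) ^ δ⌉₊ (m ^ c)) →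
      ∀ c : ℕ, ∀ᶠ m : ℕ in atTop, StrictConeRankHard m ⌈(m : ℝ) ^ δ'⌉₊ (m ^ c)

/-- Statement of `stub_unitPotentialHard` (verbatim). -/
def stub_unitPotentialHard : Prop :=
  ∀ c : ℕ, ∀ᶠ m : ℕ in atTop, ∀ q r : ℕ, q + r ≤ m ^ c →
    ¬ ConeFactorisable m ⌈(m : ℝ) ^ (1 / 2 : ℝ)⌉₊ q r (fun _ => 1) (fun _ => 1)

/-- Statement of `stub_potentialGap` (verbatim). -/
def stub_potentialGap : Prop :=
  ∃ C₁ : ℕ, ∀ (m k q r : ℕ) (a : Finset (Fin m) → ℝ) (b : (Edge m → Bool) → ℝ),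
    (∀ Q : Finset (Fin m), Q.card = k → 0 < a Q) → (∀ u, cliqueFn m k u = false → 0 < b u) →
      ConeFactorisable m k q r a b →
        ∃ q' r' : ℕ, q' + r' ≤ (q + r + m + 2) ^ C₁ ∧
          ConeFactorisable m k q' r' (fun _ => 1) (fun _ => 1)

end Stub

/-! ## Composition (real proofs, no `sorry`) -/

/-- Polynomial bookkeeping: `(q + r + m + 2)^C ≤ m^((c+2)·C)` when `q + r ≤ m^c` and `m ≥ 3`. -/
theorem pow_bookkeeping {m c q r : ℕ} (C : ℕ) (hm : 3 ≤ m) (hqr : q + r ≤ m ^ c) :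
    (q + r + m + 2) ^ C ≤ m ^ ((c + 2) * C) := by
  have h1 : 1 ≤ m := le_trans (by norm_num) hm
  have hmc : m ^ c ≤ m ^ (c + 1) := Nat.pow_le_pow_right h1 (by omega)
  have hm1 : m ≤ m ^ (c + 1) := by
    calc m = m ^ 1 := (pow_one m).symm
      _ ≤ m ^ (c + 1) := Nat.pow_le_pow_right h1 (by omega)
  have hbase : q + r + m + 2 ≤ m ^ (c + 2) := by
    calc q + r + m + 2 ≤ m ^ (c + 1) + m ^ (c + 1) + m ^ (c + 1) := by omega
      _ = 3 * m ^ (c + 1) := by ring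
      _ ≤ m * m ^ (c + 1) := Nat.mul_le_mul_right _ hm
      _ = m ^ (c + 2) := by ring
  calc (q + r + m + 2) ^ C ≤ (m ^ (c + 2)) ^ C := Nat.pow_le_pow_left hbase C
    _ = m ^ ((c + 2) * C) := by rw [← pow_mul]

/-- The two heart stubs give strict cone-rank hardness at the planted-clique scale `k = ⌈√m⌉`. -/
theorem strictConeRankHard_sqrt (h₂ : Stub.stub_unitPotentialHard) (h₃ : Stub.stub_potentialGap) :
    ∀ c : ℕ, ∀ᶠ m : ℕ in atTop, StrictConeRankHard m ⌈(m : ℝ) ^ (1 / 2 : ℝ)⌉₊ (m ^ c) := by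
  obtain ⟨C₁, hC⟩ := h₃
  intro c
  filter_upwards [h₂ ((c + 2) * C₁), eventually_ge_atTop 3] with m hm h3m
  intro q r hqr a b ha hb hfact
  obtain ⟨q', r', hle, hunit⟩ := hC m _ q r a b ha hb hfact
  exact hm q' r' (hle.trans (pow_bookkeeping C₁ h3m hqr)) hunit

/-- The crux under a LOCAL name, so that exactly the two theorems `ConvexGateBlind_of` / `ConvexGateBlind_skeleton`
conclude `ConvexGateBlind` literally (the skeleton audit takes the crux-concluding theorem of this file by name). -/
def LineTarget : Prop := ConvexGateBlind

/-- Strict cone-rank hardness at ANY exponent `δ ∈ (0, 1/2)` is the crux.  This is the forward half of the provers'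
canonical form (`convexGateBlind_iff_cliqueDistConeRankHard`, `…CanonicalForm.lean`), re-derived here from the BUILT
modules: collapse to one gate (`convexGateBlind_iff_oneGate`), wiring (`oneGateHard_iff_dataHard`), and "CONV data
computing CLIQUE ⇒ cone factorisation of `D − εJ`" (`convGate_cliqueDist_coneFactorisation`, sizes `q + (p + 2#E + 3)
≤ m^(c+3)` for `m ≥ 4`); then specialise the potential to the constant one, `a ≡ ε`, `b ≡ 1`. -/
theorem convexGateBlind_of_strictConeRankHard {δ : ℝ} (hδ0 : 0 < δ) (hδ : δ < 1 / 2)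
    (h : ∀ c : ℕ, ∀ᶠ m : ℕ in atTop, StrictConeRankHard m ⌈(m : ℝ) ^ δ⌉₊ (m ^ c)) : LineTarget := by
  classical
  unfold LineTarget
  rw [Summit.PneNP.PneNP.Theorems.convexGateBlind_iff_oneGate]
  refine ⟨δ, hδ0, hδ, fun c => ?_⟩
  filter_upwards [h (c + 3), eventually_ge_atTop 4] with m hm hm4
  refine (Summit.PneNP.PneNP.Theorems.oneGateHard_iff_dataHard m ⌈(m : ℝ) ^ δ⌉₊ (m ^ c)).2 ?_
  intro p q hpq A b B hB hiff
  obtain ⟨ε, hε, H', Y', U, V, hH', hY', hU, hV, hfact⟩ :=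
    Summit.PneNP.PneNP.Theorems.convGate_cliqueDist_coneFactorisation A b B hB hiff
  set eL := Fintype.equivFin ((Fin p ⊕ Unit) ⊕
    (((⊤ : SimpleGraph (Fin m)).edgeSet ⊕ (⊤ : SimpleGraph (Fin m)).edgeSet) ⊕ Unit)) with heL
  have hcard : q + Fintype.card ((Fin p ⊕ Unit) ⊕
      (((⊤ : SimpleGraph (Fin m)).edgeSet ⊕ (⊤ : SimpleGraph (Fin m)).edgeSet) ⊕ Unit)) ≤ m ^ (c + 3) := by
    have hn : Fintype.card (⊤ : SimpleGraph (Fin m)).edgeSet ≤ m ^ 2 :=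
      Summit.PneNP.PneNP.Theorems.card_edgeSet_top_le m
    simp only [Fintype.card_sum, Fintype.card_fin, Fintype.card_unique]
    have h1 : 1 ≤ m := by omega
    have e1 : m ^ c ≤ m ^ (c + 2) := Nat.pow_le_pow_right h1 (by omega)
    have e2 : m ^ 2 ≤ m ^ (c + 2) := Nat.pow_le_pow_right h1 (by omega)
    have e3 : 1 ≤ m ^ (c + 2) := Nat.one_le_pow _ _ h1
    have e4 : 4 * m ^ (c + 2) ≤ m ^ (c + 3) := by
      calc 4 * m ^ (c + 2) = m ^ (c + 2) * 4 := Nat.mul_comm _ _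
        _ ≤ m ^ (c + 2) * m := Nat.mul_le_mul_left _ hm4
        _ = m ^ (c + 3) := (pow_succ m (c + 2)).symm
    have e5 : m ≤ m ^ (c + 2) := by
      calc m = m ^ 1 := (pow_one m).symm
        _ ≤ m ^ (c + 2) := Nat.pow_le_pow_right h1 (by omega)
    omega
  refine hm q _ hcard (fun _ => ε) (fun _ => 1) (fun _ _ => hε) (fun _ _ => one_pos)
    ⟨H', Y', fun u i => U u (eL.symm i), fun i Q => V (eL.symm i) Q, hH', hY',
      fun u i => hU u _, fun i Q => hV _ Q, fun Q u hQ hu => ?_⟩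
  show cdist Q u - ε * 1 = _
  rw [mul_one, cdist, hfact Q u hQ hu, ← Equiv.sum_comp eL.symm (fun l => U u l * V l Q)]

/-- **`ConvexGateBlind_of`** — the line's composition: the three stubs imply the crux (by name). -/
theorem ConvexGateBlind_of (h₁ : Stub.stub_exponentDown) (h₂ : Stub.stub_unitPotentialHard)
    (h₃ : Stub.stub_potentialGap) : ConvexGateBlind :=
  convexGateBlind_of_strictConeRankHard (δ := 1 / 4) (by norm_num) (by norm_num)
    (h₁ (1 / 2) (1 / 4) (by norm_num) (by norm_num) (by norm_num) (strictConeRankHard_sqrt h₂ h₃))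

/-- The assembled skeleton: the crux from the registered stubs (their `sorry`s are the only gaps). -/
theorem ConvexGateBlind_skeleton : ConvexGateBlind :=
  ConvexGateBlind_of stub_exponentDown stub_unitPotentialHard stub_potentialGap

end

end Summit.PneNP.PneNP.Cruxes.ConvexGateBlind.StrictRankConicCover
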